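import Summits.AtomisticToContinuum.BoseEinsteinCondensation.Theorems.FibreConductance.Negative.TestFunction
import Literature.MathematicalPhysics.QuantumManyBody.PeriodicBoseGasKineticMultiplierProofs

/-!
# Crux `FibreConductance` (stmt-AtomisticToContinuum-9480) — negative-side toolkit: the gradient
charge `ε♭` of the two-slab state

Refuter (drefute) support file for the line `parseval-shell-bootstrap`, stub 4 `GradientComparability`
(landscape half for the oscillating charge).  The stub's vocabulary written over `FibreVocabulary`
(`skelKsq`, `dPsi`, `gradDefect`, `flatEnergy`: verbatim the skeleton's `Lines/parseval-shell-bootstrap.lean`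
§0 up to the names of `W, ψ, β, e^{ik·x}`), evaluated EXACTLY on the disprover's two-slab product state
`Φ = φ^{⊗N}`, `φ = slabFactor L σ = G(y₀)` (`SlabState.lean`):  `ψ(X) = G(x₀₀)` so
`∂ψ/∂x_{0,l} = G'(x₀₀)·[l = 0]` (`fderiv_fibrePsi_slab`), `β = 0` (odd harmonic against an
`L/2`-periodic profile), hence `ε♭ = -i L^{-3/2} (L/2π) e^{iθ(x₀₀)} G'(x₀₀)` (`gradDefect_slab`), a
charge living in the four transition layers of the barriers; its flat corrector energy is tiny:
`flatEnergy ≤ 64K²/(π²L)` per fibre (`flatEnergy_slab_le`, Parseval on the fibre, `|G'| ≤ 16πK/(L√Z)`, and the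
lattice fact `one_le_sum_sq_of_ne_zero` of `PeriodicBoseGasKineticMultiplierProofs`),
so `∫_{cellN} W·flatEnergy ≤ 64K²L²/π²` (`lintegral_flat_slab_le`).  Consumed by
`SlabGradientPairing.lean` / `GradientComparabilityNearMinimiser.lean`.  All [folklore].
-/

noncomputable section

namespace Summit.AtomisticToContinuum.BoseEinsteinCondensation.Theorems.FibreConductance.Negative

open MeasureTheory Literature.MathematicalPhysics.QuantumManyBody.BoseGas Real
open Summit.AtomisticToContinuum.BoseEinsteinCondensation.Theorems.GaussianDominationCan.Negative
open scoped ENNReal NNReal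

variable {m : ℕ} {L σ : ℝ}

/-! ### The stub's vocabulary over `FibreVocabulary` -/

/-- `|k|² = (2π/L)² Σ_j n_j²` (the skeleton's `ksq`; renamed, `FreeConstantFlow.ksq` being the disprover's `4π²|n|²/L²`). -/
def skelKsq (L : ℝ) (n : Fin 3 → ℤ) : ℝ :=
  (2 * π / L) ^ 2 * ∑ j, (n j : ℝ) ^ 2

/-- `∂ψ/∂x_{0,l}`: partial derivative of the conditional amplitude in the fibre variable (the
skeleton's `dPsi`, over `FibreVocabulary.fibrePsi`). -/
def dPsi (L : ℝ) (φ : Config (m + 1) → ℂ) (X : Config (m + 1)) (l : Fin 3) : ℝ :=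
  fderiv ℝ (fibrePsi L φ) X (Pi.single 0 (EuclideanSpace.single l (1 : ℝ)))

/-- The flat-neutralised gradient charge `ε♭ = L^{-3/2}[e^{ik·x₀}(k·∇₀ψ)/(i|k|²) + β/L³]` (the
skeleton's `gradDefect`, with `wave = phase`, `fibreBeta`, `fibrePsi` of `FibreVocabulary`). -/
def gradDefect (L : ℝ) (n : Fin 3 → ℤ) (φ : Config (m + 1) → ℂ) (X : Config (m + 1)) : ℂ :=
  ((Real.sqrt (L ^ 3))⁻¹ : ℂ) *
    (wave L n (X 0) * (↑(∑ l : Fin 3, 2 * π * (n l : ℝ) / L * dPsi L φ X l) /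
        (Complex.I * (skelKsq L n : ℂ))) +
      fibreBeta L n φ X / ((L : ℂ) ^ 3))

/-- The flat corrector energy of `ε♭` in the fibre of `X̂`:
`L³ Σ_{p≠0} |ĉ_p(ε♭(·,X̂))|²/|2πp/L|²` (the skeleton's `flatEnergy`). -/
def flatEnergy (L : ℝ) (n : Fin 3 → ℤ) (φ : Config (m + 1) → ℂ) (X : Config (m + 1)) : ℝ≥0∞ :=
  ENNReal.ofReal (L ^ 3) *
    ∑' p : Fin 3 → ℤ, if p = 0 then 0 else
      ENNReal.ofReal (‖cellFourierCoeff L (fun y => gradDefect L n φ (Function.update X 0 y)) p‖ ^ 2 /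
        ((2 * π / L) ^ 2 * ∑ j, (p j : ℝ) ^ 2))

/-! ### `ψ` of the slab state and its fibre gradient -/

/-- `ψ` of the slab state is the profile of the first coordinate: `ψ(X) = G(x₀₀)`. [folklore] -/
theorem fibrePsi_slab_eq (hL : 0 < L) (hσ0 : 0 < σ) (hσ1 : σ ≤ 1) :
    fibrePsi L (realProd m (slabFactor L σ)) = fun X => slabG L σ (X 0 0) := by
  funext X
  rw [fibrePsi_realProd (slabFactor_pos hL hσ0 hσ1) (integral_sq_slabFactor hL hσ0.le hσ1)]
  rfl

/-- The coordinate `X ↦ x₀₀` as a continuous linear functional on configurations. [folklore] -/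
def coord00 (m : ℕ) : Config (m + 1) →L[ℝ] ℝ :=
  coord0.comp (ContinuousLinearMap.proj (R := ℝ) (φ := fun _ : Fin (m + 1) => Space) 0)

/-- `coord00 X = x₀₀`. [folklore] -/
@[simp] theorem coord00_apply (X : Config (m + 1)) : coord00 m X = X 0 0 := rfl

/-- `coord00 (e_{0,l}) = [l = 0]`. [folklore] -/
theorem coord00_single (l : Fin 3) :
    coord00 m (Pi.single 0 (EuclideanSpace.single l (1 : ℝ)) : Config (m + 1)) =
      if l = 0 then 1 else 0 := by
  rw [coord00_apply, Pi.single_eq_same]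
  simp [PiLp.single_apply, eq_comm]

/-- The fibre gradient of `ψ` for the slab state: `X ↦ G(x₀₀)` has derivative `G'(x₀₀)·coord00`.
[folklore] -/
theorem hasFDerivAt_slabG_coord00 (X : Config (m + 1)) :
    HasFDerivAt (fun X : Config (m + 1) => slabG L σ (X 0 0))
      (deriv (slabG L σ) (X 0 0) • coord00 m) X := by
  have h := (((contDiff_slabG L σ).differentiable one_ne_zero) (X 0 0)).hasDerivAt
  exact h.comp_hasFDerivAt X (coord00 m).hasFDerivAt

/-- **`∂ψ/∂x_{0,l} = G'(x₀₀)·[l = 0]`** for the slab state. [folklore] -/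
theorem dPsi_slab (hL : 0 < L) (hσ0 : 0 < σ) (hσ1 : σ ≤ 1) (X : Config (m + 1)) (l : Fin 3) :
    dPsi L (realProd m (slabFactor L σ)) X l = if l = 0 then deriv (slabG L σ) (X 0 0) else 0 := by
  unfold dPsi
  rw [fibrePsi_slab_eq hL hσ0 hσ1, (hasFDerivAt_slabG_coord00 X).fderiv]
  simp only [FunLike.coe_smul, Pi.smul_apply, coord00_single, smul_eq_mul]
  split_ifs <;> simp

/-- **`β = 0`** for the slab state (`e₀` is an odd harmonic, `G` is `L/2`-periodic). [folklore] -/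
theorem fibreBeta_slab (hL : 0 < L) (hσ0 : 0 < σ) (hσ1 : σ ≤ 1) (X : Config (m + 1)) :
    fibreBeta L e0 (realProd m (slabFactor L σ)) X = 0 := by
  rw [fibreBeta_realProd (slabFactor_pos hL hσ0 hσ1) (integral_sq_slabFactor hL hσ0.le hσ1),
    integral_wave_mul_slabFactor hL σ]

/-- `|k|² = (2π/L)²` for `n = e₀`. [folklore] -/
theorem skelKsq_e0 (L : ℝ) : skelKsq L e0 = (2 * π / L) ^ 2 := by
  unfold skelKsq
  rw [show (∑ j, ((e0 j : ℤ) : ℝ) ^ 2) = nsq e0 from rfl, nsq_e0, mul_one]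

/-- `k·∇₀ψ = (2π/L) G'(x₀₀)` for the slab state and `n = e₀`. [folklore] -/
theorem sum_dPsi_slab (hL : 0 < L) (hσ0 : 0 < σ) (hσ1 : σ ≤ 1) (X : Config (m + 1)) :
    ∑ l : Fin 3, 2 * π * ((e0 l : ℤ) : ℝ) / L * dPsi L (realProd m (slabFactor L σ)) X l =
      2 * π / L * deriv (slabG L σ) (X 0 0) := by
  simp_rw [dPsi_slab hL hσ0 hσ1]
  simp [e0]

/-- **The gradient charge of the slab state**:
`ε♭(X) = L^{-3/2} e^{iθ(x₀₀)} · ((L/2π) G'(x₀₀)) · (-i)`. [folklore] -/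
theorem gradDefect_slab (hL : 0 < L) (hσ0 : 0 < σ) (hσ1 : σ ≤ 1) (X : Config (m + 1)) :
    gradDefect L e0 (realProd m (slabFactor L σ)) X =
      ((Real.sqrt (L ^ 3))⁻¹ : ℂ) * (wave L e0 (X 0) *
        ((((L / (2 * π) * deriv (slabG L σ) (X 0 0) : ℝ)) : ℂ) * (-Complex.I))) := by
  unfold gradDefect
  rw [sum_dPsi_slab hL hσ0 hσ1, fibreBeta_slab hL hσ0 hσ1, zero_div, add_zero, skelKsq_e0]
  congr 1
  congr 1
  have hr : 2 * π / L * deriv (slabG L σ) (X 0 0) / (2 * π / L) ^ 2 =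
      L / (2 * π) * deriv (slabG L σ) (X 0 0) := by
    field_simp
  rw [div_mul_eq_div_div_swap, ← Complex.ofReal_div, hr, Complex.div_I]
  ring

/-! ### The flat corrector energy of the slab's `ε♭` is small -/

/-- The fibre slice of `ε♭` for the slab state (independent of the bath point `X̂`). [folklore] -/
theorem gradDefect_slab_update (hL : 0 < L) (hσ0 : 0 < σ) (hσ1 : σ ≤ 1) (X : Config (m + 1))
    (y : Space) :
    gradDefect L e0 (realProd m (slabFactor L σ)) (Function.update X 0 y) =
      ((Real.sqrt (L ^ 3))⁻¹ : ℂ) * (wave L e0 y *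
        ((((L / (2 * π) * deriv (slabG L σ) (y 0) : ℝ)) : ℂ) * (-Complex.I))) := by
  rw [gradDefect_slab hL hσ0 hσ1, Function.update_self]

/-- The slice of `ε♭` is continuous. [folklore] -/
theorem continuous_gradDefect_slab_slice (hL : 0 < L) (hσ0 : 0 < σ) (hσ1 : σ ≤ 1)
    (X : Config (m + 1)) :
    Continuous fun y : Space => gradDefect L e0 (realProd m (slabFactor L σ)) (Function.update X 0 y) := by
  simp_rw [gradDefect_slab_update hL hσ0 hσ1, wave_eq_cellWave]
  have hd : Continuous (deriv (slabG L σ)) := (contDiff_slabG L σ).continuous_deriv le_rfl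
  have h1 : Continuous fun y : Space => (((L / (2 * π) * deriv (slabG L σ) (y 0) : ℝ)) : ℂ) :=
    Complex.continuous_ofReal.comp (continuous_const.mul (hd.comp (continuous_apply 0 |>.comp
      (PiLp.continuous_ofLp 2 _))))
  exact continuous_const.mul ((continuous_cellWave L e0).mul (h1.mul continuous_const))

/-- **Pointwise size of `ε♭`**: `‖ε♭‖² ≤ 256K²/L⁶` (from `G'² ≤ (16πK/L)²·4/L³`). [folklore] -/
theorem norm_sq_gradDefect_slab_le (hL : 0 < L) (hσ0 : 0 < σ) (hσ1 : σ ≤ 1) {K : ℝ}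
    (hK : ∀ x, |deriv smoothTransition x| ≤ K) (X : Config (m + 1)) (y : Space) :
    ‖gradDefect L e0 (realProd m (slabFactor L σ)) (Function.update X 0 y)‖ ^ 2 ≤
      256 * K ^ 2 / L ^ 6 := by
  have hL3 : 0 < L ^ 3 := by positivity
  rw [gradDefect_slab_update hL hσ0 hσ1, norm_mul, norm_mul, norm_mul, norm_neg, Complex.norm_I,
    mul_one, wave_eq_cellWave, norm_cellWave, one_mul, Complex.norm_real, Real.norm_eq_abs,
    ← Complex.ofReal_inv, Complex.norm_real, Real.norm_of_nonneg (by positivity), mul_pow, inv_pow,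
    Real.sq_sqrt hL3.le, sq_abs, mul_pow]
  have hG := deriv_slabG_sq_le hL hσ0.le hσ1 hK (y 0)
  calc (L ^ 3)⁻¹ * ((L / (2 * π)) ^ 2 * deriv (slabG L σ) (y 0) ^ 2)
      ≤ (L ^ 3)⁻¹ * ((L / (2 * π)) ^ 2 * ((16 * π * K / L) ^ 2 * (4 / L ^ 3))) := by gcongr
    _ = 256 * K ^ 2 / L ^ 6 := by field_simp; ring

/-- **The flat corrector energy of `ε♭` per fibre is `≤ 64K²/(π²L)`** (Parseval on the fibre,
`|2πp/L|² ≥ (2π/L)²` for `p ≠ 0`). [folklore] -/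
theorem flatEnergy_slab_le (hL : 0 < L) (hσ0 : 0 < σ) (hσ1 : σ ≤ 1) {K : ℝ}
    (hK : ∀ x, |deriv smoothTransition x| ≤ K) (X : Config (m + 1)) :
    flatEnergy L e0 (realProd m (slabFactor L σ)) X ≤ ENNReal.ofReal (64 * K ^ 2 / (π ^ 2 * L)) := by
  have hL3 : 0 < L ^ 3 := by positivity
  unfold flatEnergy
  set s : Space → ℂ := fun y => gradDefect L e0 (realProd m (slabFactor L σ)) (Function.update X 0 y)
    with hs
  have hcont : Continuous s := continuous_gradDefect_slab_slice hL hσ0 hσ1 X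
  have hterm : ∀ p : Fin 3 → ℤ,
      (if p = 0 then 0 else ENNReal.ofReal (‖cellFourierCoeff L s p‖ ^ 2 /
        ((2 * π / L) ^ 2 * ∑ j, (p j : ℝ) ^ 2))) ≤
      ENNReal.ofReal ((L / (2 * π)) ^ 2) * ((‖cellFourierCoeff L s p‖₊ : ℝ≥0∞) ^ 2) := by
    intro p
    split_ifs with hp
    · exact bot_le
    rw [coe_nnnorm_sq_eq_ofReal, ← ENNReal.ofReal_mul (sq_nonneg _)]
    apply ENNReal.ofReal_le_ofReal
    have h1 := one_le_sum_sq_of_ne_zero hp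
    rw [div_le_iff₀ (by positivity)]
    calc ‖cellFourierCoeff L s p‖ ^ 2 = ‖cellFourierCoeff L s p‖ ^ 2 * 1 := by ring
      _ ≤ ‖cellFourierCoeff L s p‖ ^ 2 * ∑ j, (p j : ℝ) ^ 2 := by gcongr
      _ = (L / (2 * π)) ^ 2 * ‖cellFourierCoeff L s p‖ ^ 2 * ((2 * π / L) ^ 2 * ∑ j, (p j : ℝ) ^ 2) := by
          field_simp
  have hpt : ∀ y, ((‖s y‖₊ : ℝ≥0∞) ^ 2) ≤ ENNReal.ofReal (256 * K ^ 2 / L ^ 6) := fun y => by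
    rw [coe_nnnorm_sq_eq_ofReal]
    exact ENNReal.ofReal_le_ofReal (norm_sq_gradDefect_slab_le hL hσ0 hσ1 hK X y)
  calc ENNReal.ofReal (L ^ 3) * ∑' p : Fin 3 → ℤ, (if p = 0 then 0 else
          ENNReal.ofReal (‖cellFourierCoeff L s p‖ ^ 2 / ((2 * π / L) ^ 2 * ∑ j, (p j : ℝ) ^ 2)))
      ≤ ENNReal.ofReal (L ^ 3) * ∑' p : Fin 3 → ℤ,
          ENNReal.ofReal ((L / (2 * π)) ^ 2) * ((‖cellFourierCoeff L s p‖₊ : ℝ≥0∞) ^ 2) := by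
        exact mul_le_mul' le_rfl (ENNReal.tsum_le_tsum hterm)
    _ = ENNReal.ofReal (L ^ 3) * (ENNReal.ofReal ((L / (2 * π)) ^ 2) *
          ((ENNReal.ofReal L ^ 3)⁻¹ * ∫⁻ y in cell L, ((‖s y‖₊ : ℝ≥0∞) ^ 2))) := by
        rw [ENNReal.tsum_mul_left, tsum_sq_cellFourierCoeff hL hcont]
    _ ≤ ENNReal.ofReal (L ^ 3) * (ENNReal.ofReal ((L / (2 * π)) ^ 2) *
          ((ENNReal.ofReal L ^ 3)⁻¹ * ∫⁻ _y in cell L, ENNReal.ofReal (256 * K ^ 2 / L ^ 6))) := by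
        exact mul_le_mul' le_rfl (mul_le_mul' le_rfl (mul_le_mul' le_rfl (lintegral_mono hpt)))
    _ = ENNReal.ofReal (L ^ 3 * ((L / (2 * π)) ^ 2 * ((L ^ 3)⁻¹ * (256 * K ^ 2 / L ^ 6 * L ^ 3)))) := by
        rw [setLIntegral_const, volume_cell, ← ENNReal.ofReal_pow hL.le,
          (ENNReal.ofReal_inv_of_pos hL3).symm, ← ENNReal.ofReal_mul (by positivity),
          ← ENNReal.ofReal_mul (by positivity), ← ENNReal.ofReal_mul (by positivity),
          ← ENNReal.ofReal_mul (by positivity)]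
    _ = ENNReal.ofReal (64 * K ^ 2 / (π ^ 2 * L)) := by
        congr 1
        field_simp
        ring

/-- **The bath-averaged flat energy of the slab's `ε♭`**: `∫_{cellN} W·flatEnergy ≤ 64K²L²/π²`.
[folklore] -/
theorem lintegral_flat_slab_le (hL : 0 < L) (hσ0 : 0 < σ) (hσ1 : σ ≤ 1) {K : ℝ}
    (hK : ∀ x, |deriv smoothTransition x| ≤ K) :
    ∫⁻ X in cellN (m + 1) L, ENNReal.ofReal (fibreW L (realProd m (slabFactor L σ)) X) *
        flatEnergy L e0 (realProd m (slabFactor L σ)) X ≤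
      ENNReal.ofReal (64 * K ^ 2 * L ^ 2 / π ^ 2) := by
  have hφ := slabFactor_pos hL hσ0 hσ1
  have hn := integral_sq_slabFactor hL hσ0.le hσ1
  have hF : Measurable fun y : Space => ENNReal.ofReal (slabFactor L σ y ^ 2) :=
    ((continuous_slabFactor L σ).pow 2).measurable.ennreal_ofReal
  calc ∫⁻ X in cellN (m + 1) L, ENNReal.ofReal (fibreW L (realProd m (slabFactor L σ)) X) *
          flatEnergy L e0 (realProd m (slabFactor L σ)) X
      ≤ ∫⁻ X in cellN (m + 1) L, ENNReal.ofReal (fibreW L (realProd m (slabFactor L σ)) X) *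
          ENNReal.ofReal (64 * K ^ 2 / (π ^ 2 * L)) :=
        lintegral_mono fun X => mul_le_mul' le_rfl (flatEnergy_slab_le hL hσ0 hσ1 hK X)
    _ = (∫⁻ X in cellN (m + 1) L,
          ∏ j ∈ Finset.univ.erase (0 : Fin (m + 1)), ENNReal.ofReal (slabFactor L σ (X j) ^ 2)) *
          ENNReal.ofReal (64 * K ^ 2 / (π ^ 2 * L)) := by
        rw [lintegral_mul_const' _ _ ENNReal.ofReal_ne_top]
        congr 1
        refine lintegral_congr fun X => ?_
        rw [fibreW_realProd hφ hn, ofReal_bathProd]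
    _ = ENNReal.ofReal L ^ 3 * ENNReal.ofReal (64 * K ^ 2 / (π ^ 2 * L)) := by
        rw [lintegral_prod_erase 0 hF]
        simp only [lintegral_ofReal_sq_slabFactor hL hσ0.le hσ1, Finset.prod_const_one, mul_one]
    _ = ENNReal.ofReal (64 * K ^ 2 * L ^ 2 / π ^ 2) := by
        rw [← ENNReal.ofReal_pow hL.le, ← ENNReal.ofReal_mul (by positivity)]
        congr 1
        field_simp

end Summit.AtomisticToContinuum.BoseEinsteinCondensation.Theorems.FibreConductance.Negative

end
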